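import Summits.HodgeConjecture.HodgeConjecture.Theorems.Ring2AbelianAllAndreInvariantHodgeTypes
import Literature.AlgebraicGeometry.HodgeTheory.HodgeConjectureQbarVoisinProofs
import HarnessLib

/-!
# Ring 2 · sub-cell AbelianAll (ALL ABELIAN VARIETIES), André axis, part XVII-a — RATIONALITY RIGIDITY OF
# INVARIANT CLASSES and THE NODES WITHOUT THEIR FIBREWISE HODGE BINDER: on a compact pencil a global class is
# rational on one fibre iff on every fibre, is a Hodge class on one fibre iff on every fibre, and the transport /
# lift nodes (2), (3), (4), (L), (L∀) are EQUIVALENT to their forms for RATIONAL global classes with no Hodge-type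
# hypothesis at all

HONEST FRAMING (page 1, verbatim): **research route, not a corollary; conditional on HC_CM plus one named
minimal statement.** Cell line: research route conditional on HC_CM; not a corollary; Q11.4-sentence-2
already refuted in dim ≥ 3. Nothing in this file proves a case of the Hodge conjecture for an abelian variety.
`HC_CM` = `Theses.RankFourFaces.CMAbelianHodge` is a BINDER wherever it occurs (one row,
`HC_AV_of_HC_CM_and_cmAnchoredTransport_rational`, binder `hCM`); item
`Theses.RankFourFaces.CMToAbelian` (stmt-16267) OPEN and not closed here. Seat `pub-hodge-ring2-ab-andre-2`,
gen 9; owed item (o22) of RING2-MAP §AbelianAll AA2.67 ("rationality rigidity on the carriers, then the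
one-fibre binders of nodes (4)/(L)/(L∀)").

## What is proved (theorems only; no definition, no named fact, no sorry)

Throughout `f : 𝒳 ⟶ S` is a compact pencil of abelian `d`-folds (`Motives.IsCompactAbelianPencil`),
`j_t : 𝒳_t ↪ 𝒳` the fibre inclusions, `W ∈ Hᵏ(𝒳(ℂ); ℂ)` a global class.

§1 **Rational lifts along the pencil.** `exists_isRationalClass_map_fiberι_eq`: if `j_t^* W` is RATIONAL for one
`t`, then some RATIONAL global class `W₀ ∈ Hᵏ(𝒳(ℂ); ℚ) ⊗ 1` has `j_s^* W₀ = j_s^* W` for EVERY `s` (rational descent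
of ranges `im (j_t^* ⊗ ℂ) ∩ Hᵏ(𝒳_t; ℚ) = im j_t^*` — the tree's `exists_isRationalClass_complexBetti_map_eq`,
universal coefficients — and André's flatness (A4) `map_fiberι_eq_zero_of_eq_zero`). Hence
**`isRationalClass_map_fiberι_iff` — RATIONALITY RIGIDITY: `j_t^* W` is rational iff `j_s^* W` is rational**, and
with part XVI-a's Hodge-type rigidity **`isHodgeClass_map_fiberι_iff`: `j_t^* W` is a Hodge class (rational of
type `(p,p)`) iff `j_s^* W` is.** This is the `ℚ`-structure half of Deligne's Cor. 4.1.2 ("la structure de Hodge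
RATIONNELLE induite sur `H⁰(S, Rⁱf_*ℚ)` est indépendante de `s`") for the sections coming from the total space.

§2 **The fibrewise Hodge binder at one fibre.** The hypothesis
`∀ s, IsRationalClass (j_s^* W) ∧ IsOfHodgeType d 𝒳_s (2p) p p (j_s^* W)` of the nodes (2) `CompactAbelianPencilVHC`
(through `Abdulali1994.InvariantCyclesHoldFor`), (3) `CMPointedPencilVHC`, (4) `CMAnchoredTransport`,
(L) `CMFibreAlgebraicLift`, (L∀) `AlgebraicFixedPart` holds iff it holds at ONE fibre
(`fibrewiseHodge_iff_at`), and it holds as soon as `W` is rational on `𝒳` and ALGEBRAIC on one fibre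
(`fibrewiseHodge_of_isRationalClass_of_mem_algebraicClasses`: algebraic ⟹ type `(p,p)`, a tree theorem, then §1
and part XVI-a).

§3 **THE NODES FOR RATIONAL CLASSES, WITHOUT HODGE TYPES.** Each of (1.1)_f = `InvariantCyclesHoldFor f d` (on a
compact pencil), (2), (3), (4), (L), (L∀) is EQUIVALENT to the statement obtained by deleting the fibrewise Hodge
binder and asking instead that `W` be a RATIONAL class of the total space:
`invariantCyclesHoldFor_iff_rational`, `compactAbelianPencilVHC_iff_rational`, `cmPointedPencilVHC_iff_rational`,
`cmAnchoredTransport_iff_rational`, `cmFibreAlgebraicLift_iff_rational`, `algebraicFixedPart_iff_rational`.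
(⟹: a rational global class algebraic on one fibre satisfies the binder, §2. ⟸: a class satisfying the binder is
rational on the anchor fibre, so by §1 it has the same fibre restrictions as a rational global class, to which the
rational form applies.) So the `B_min` candidates of parts I/II read, e.g., **(4) ⟺ "on every compact pencil of
abelian varieties, a rational class of the total space which is algebraic on a CM fibre is algebraic on every
fibre"** and **(L) ⟺ "… agrees on the CM fibre with an algebraic class of the total space"** — statements about
`H²ᵖ(𝒳(ℂ); ℚ) → H²ᵖ(𝒳_t(ℂ); ℚ)` and the subspaces of algebraic classes only.

READING (RING2-MAP §AbelianAll gen 9). The Hodge-theoretic clause of every transport / lift node of the André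
axis is IDLE: given rationality on the total space (or, equivalently by §1, on one fibre), "of type `(p,p)` on
every fibre" is implied by "algebraic on one fibre". What the nodes ask is purely cycle-theoretic — the image of
`N^p(𝒳) ∩ H²ᵖ(𝒳; ℚ)` in `H²ᵖ(𝒳_t; ℚ)` versus `N^p(𝒳_t) ∩ im H²ᵖ(𝒳; ℚ)` — in line with part XV-b's exactness
theorem. EDGE LABELS: all K unconditional; no def, no named fact, no Hodge-conjecture input, `HC_CM` absent.

References: DeligneHodgeII1971 (Cor. 4.1.2, (4.1.3.1), Thm. 4.1.1); VoisinHodgeI2002 (§7.1.1, §11.3);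
VoisinHodgeII2003 (§4.3.3 Cor. 4.25); HatcherAT2002 (§3.1 Thm. 3.2, p. 198); Andre1996Motifs (§5.1 (A4) p. 25,
§6.3 p. 33); Abdulali1994FamiliesAV ((1.1) p. 1122, Lemma 6.2 p. 1131); Milne2020HodgeClassesAV (Prop. 1);
CharlesSchnell2014Notes ((11.3.1), Prop. 11.3.5).
-/

noncomputable section

set_option linter.dupNamespace false

namespace Summit.HodgeConjecture.HodgeConjecture.Ring2.AbelianAll

open CategoryTheory AlgebraicGeometry
open Literature.AlgebraicGeometry Literature.AlgebraicGeometry.Motives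
open Literature.AlgebraicGeometry.HodgeTheory
open Literature.AlgebraicGeometry.Abdulali1994 (InvariantCyclesHoldFor)
open Literature.AlgebraicGeometry.Deligne1982 (cmLocus)
open Summit.HodgeConjecture.HodgeConjecture.Ring2.Deform (CompactAbelianPencilVHC)

variable {𝒳 S : SchemeOver ℂ}

/-! ## §1 Rational lifts along the pencil; rationality rigidity; Hodge-class rigidity -/

/-- **A class rational on ONE fibre agrees on EVERY fibre with a rational class of the total space.** On a
compact pencil `f : 𝒳 ⟶ S` of abelian `d`-folds, if `j_t^* W` is rational then there is a RATIONAL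
`W₀ ∈ Hᵏ(𝒳(ℂ); ℂ)` with `j_s^* W₀ = j_s^* W` for all `s`: rational descent of ranges for `j_t : 𝒳_t ⟶ 𝒳` (a
rational class in `im (j_t^* ⊗ ℂ)` is `j_t^*` of a rational class — universal coefficients on the smooth
projective `𝒳`, the tree's `exists_isRationalClass_complexBetti_map_eq`) gives `W₀` with `j_t^* W₀ = j_t^* W`, and
`W - W₀` dies on `𝒳_t`, hence on every fibre (André's flatness (A4), `map_fiberι_eq_zero_of_eq_zero`).
[cite: VoisinHodgeI2002, §7.1.1] [cite: HatcherAT2002, §3.1 Thm. 3.2 and p. 198] [cite: Andre1996Motifs, §5.1 (p. 25)] -/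
theorem exists_isRationalClass_map_fiberι_eq {d : ℕ} {f : 𝒳 ⟶ S} (hf : IsCompactAbelianPencil f d) {k : ℕ}
    (W : complexBetti 𝒳 k) {t : ComplexPoints S} (ht : IsRationalClass (complexBetti.map (fiberι f t) k W)) :
    ∃ W₀ : complexBetti 𝒳 k, IsRationalClass W₀ ∧
      ∀ s : ComplexPoints S, complexBetti.map (fiberι f s) k W₀ = complexBetti.map (fiberι f s) k W := by
  obtain ⟨W₀, hW₀, hW₀t⟩ := exists_isRationalClass_complexBetti_map_eq hf.isSmoothProjective_total (fiberι f t) W ht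
  refine ⟨W₀, hW₀, fun s ↦ ?_⟩
  have h0 : complexBetti.map (fiberι f t) k (W₀ - W) = 0 := by rw [map_sub, hW₀t, sub_self]
  have hs : complexBetti.map (fiberι f s) k (W₀ - W) = 0 := map_fiberι_eq_zero_of_eq_zero hf h0 s
  rwa [map_sub, sub_eq_zero] at hs

/-- **RATIONALITY RIGIDITY of invariant classes** (the `ℚ`-structure half of Deligne, Hodge II, Cor. 4.1.2, for
the sections coming from the total space): on a compact pencil of abelian `d`-folds, for every
`W ∈ Hᵏ(𝒳(ℂ); ℂ)` and all `s, t`, `j_t^* W` is rational iff `j_s^* W` is rational (§1's rational lift `W₀`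
restricts to rational classes everywhere). [cite: DeligneHodgeII1971, Cor. 4.1.2] [cite: VoisinHodgeII2003, §4.3.3 Cor. 4.25]
[cite: HatcherAT2002, §3.1 p. 198] -/
theorem isRationalClass_map_fiberι_iff {d : ℕ} {f : 𝒳 ⟶ S} (hf : IsCompactAbelianPencil f d) {k : ℕ}
    (W : complexBetti 𝒳 k) (s t : ComplexPoints S) :
    IsRationalClass (complexBetti.map (fiberι f t) k W) ↔ IsRationalClass (complexBetti.map (fiberι f s) k W) := by
  constructor
  · intro ht
    obtain ⟨W₀, hW₀, hW₀s⟩ := exists_isRationalClass_map_fiberι_eq hf W ht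
    rw [← hW₀s s]
    exact hW₀.map (AlgPoints.mapContinuous (L := ℂ) (fiberι f s))
  · intro hs
    obtain ⟨W₀, hW₀, hW₀s⟩ := exists_isRationalClass_map_fiberι_eq hf W hs
    rw [← hW₀s t]
    exact hW₀.map (AlgPoints.mapContinuous (L := ℂ) (fiberι f t))

/-- Rationality at one fibre gives rationality at all fibres. [cite: DeligneHodgeII1971, Cor. 4.1.2] -/
theorem isRationalClass_map_fiberι_all_of_at {d : ℕ} {f : 𝒳 ⟶ S} (hf : IsCompactAbelianPencil f d) {k : ℕ}
    {W : complexBetti 𝒳 k} {t : ComplexPoints S} (ht : IsRationalClass (complexBetti.map (fiberι f t) k W))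
    (s : ComplexPoints S) : IsRationalClass (complexBetti.map (fiberι f s) k W) :=
  (isRationalClass_map_fiberι_iff hf W s t).1 ht

/-- **HODGE-CLASS RIGIDITY of invariant classes** (Deligne, Hodge II, Cor. 4.1.2 / (4.1.3.1) with its
`ℚ`-structure, for the sections coming from the total space): on a compact pencil of abelian `d`-folds, `j_t^* W`
is a Hodge class — rational of type `(p,q)` — iff `j_s^* W` is (rationality: the previous theorem; type: part
XVI-a's `isOfHodgeType_map_fiberι_iff`). [cite: DeligneHodgeII1971, Cor. 4.1.2 and (4.1.3.1)]
[cite: VoisinHodgeII2003, §4.3.3 Cor. 4.25] -/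
theorem isHodgeClass_map_fiberι_iff {d : ℕ} {f : 𝒳 ⟶ S} (hf : IsCompactAbelianPencil f d) {k p q : ℕ}
    (W : complexBetti 𝒳 k) (s t : ComplexPoints S) :
    (IsRationalClass (complexBetti.map (fiberι f t) k W) ∧
        IsOfHodgeType d (fiberOver f t) k p q (complexBetti.map (fiberι f t) k W)) ↔
      (IsRationalClass (complexBetti.map (fiberι f s) k W) ∧
        IsOfHodgeType d (fiberOver f s) k p q (complexBetti.map (fiberι f s) k W)) :=
  and_congr (isRationalClass_map_fiberι_iff hf W s t) (isOfHodgeType_map_fiberι_iff hf W s t)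

/-! ## §2 The fibrewise Hodge binder of the nodes, at one fibre -/

/-- **The fibrewise Hodge binder holds at every fibre iff at one.** The hypothesis
"`j_s^* W` rational of type `(p,p)` for every `s`" of the nodes (1.1)_f, (2), (3), (4), (L), (L∀) is equivalent to
its instance at any single fibre `t₀`. [cite: DeligneHodgeII1971, Cor. 4.1.2 and (4.1.3.1)] -/
theorem fibrewiseHodge_iff_at {d : ℕ} {f : 𝒳 ⟶ S} (hf : IsCompactAbelianPencil f d) {p : ℕ}
    (W : complexBetti 𝒳 (2 * p)) (t₀ : ComplexPoints S) :
    (∀ s : ComplexPoints S, IsRationalClass (complexBetti.map (fiberι f s) (2 * p) W) ∧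
        IsOfHodgeType d (fiberOver f s) (2 * p) p p (complexBetti.map (fiberι f s) (2 * p) W)) ↔
      (IsRationalClass (complexBetti.map (fiberι f t₀) (2 * p) W) ∧
        IsOfHodgeType d (fiberOver f t₀) (2 * p) p p (complexBetti.map (fiberι f t₀) (2 * p) W)) :=
  ⟨fun h ↦ h t₀, fun h s ↦ (isHodgeClass_map_fiberι_iff hf W s t₀).1 h⟩

/-- **A rational global class which is ALGEBRAIC on one fibre satisfies the fibrewise Hodge binder**: its
restrictions are rational (pull-backs of a rational class) and of type `(p,p)` on the algebraic fibre (algebraic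
classes are of type `(p,p)`, the tree's `isOfHodgeType_of_mem_algebraicClasses_of_isSmoothProjective`), hence on
every fibre (part XVI-a's rigidity). [cite: VoisinHodgeI2002, §11.3 Prop. 11.20] [cite: DeligneHodgeII1971, (4.1.3.1)] -/
theorem fibrewiseHodge_of_isRationalClass_of_mem_algebraicClasses {d : ℕ} {f : 𝒳 ⟶ S}
    (hf : IsCompactAbelianPencil f d) {p : ℕ} {W : complexBetti 𝒳 (2 * p)} (hW : IsRationalClass W)
    {t : ComplexPoints S} (ht : complexBetti.map (fiberι f t) (2 * p) W ∈ algebraicClasses (fiberOver f t) p)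
    (s : ComplexPoints S) :
    IsRationalClass (complexBetti.map (fiberι f s) (2 * p) W) ∧
      IsOfHodgeType d (fiberOver f s) (2 * p) p p (complexBetti.map (fiberι f s) (2 * p) W) :=
  ⟨hW.map (AlgPoints.mapContinuous (L := ℂ) (fiberι f s)),
    (isOfHodgeType_map_fiberι_iff hf W s t).1
      (isOfHodgeType_of_mem_algebraicClasses_of_isSmoothProjective (hf.isSmoothProjective_fiberOver t) p ht)⟩

/-- **A class satisfying the fibrewise Hodge binder has the fibre restrictions of a RATIONAL global class** (only
rationality at one fibre is used). [cite: VoisinHodgeI2002, §7.1.1] [cite: Andre1996Motifs, §5.1 (p. 25)] -/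
theorem exists_isRationalClass_map_fiberι_eq_of_fibrewiseHodge {d : ℕ} {f : 𝒳 ⟶ S}
    (hf : IsCompactAbelianPencil f d) {p : ℕ} (W : complexBetti 𝒳 (2 * p))
    (hW : ∀ s : ComplexPoints S, IsRationalClass (complexBetti.map (fiberι f s) (2 * p) W) ∧
      IsOfHodgeType d (fiberOver f s) (2 * p) p p (complexBetti.map (fiberι f s) (2 * p) W))
    (t : ComplexPoints S) :
    ∃ W₀ : complexBetti 𝒳 (2 * p), IsRationalClass W₀ ∧
      ∀ s : ComplexPoints S, complexBetti.map (fiberι f s) (2 * p) W₀ = complexBetti.map (fiberι f s) (2 * p) W :=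
  exists_isRationalClass_map_fiberι_eq hf W (hW t).1

/-! ## §3 The nodes for rational classes of the total space, with no Hodge-type hypothesis -/

/-- **(1.1)_f without its Hodge binder.** On a compact pencil of abelian `d`-folds, Abdulali's transport statement
`InvariantCyclesHoldFor f d` is EQUIVALENT to: for every `p` and every RATIONAL `W ∈ H²ᵖ(𝒳(ℂ); ℂ)`, if `j_{s₀}^* W`
is algebraic for one `s₀` then `j_s^* W` is algebraic for every `s`. [cite: Abdulali1994FamiliesAV, (1.1) (p. 1122)]
[cite: CharlesSchnell2014Notes, (11.3.1) and Prop. 11.3.5] [cite: DeligneHodgeII1971, Cor. 4.1.2] -/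
theorem invariantCyclesHoldFor_iff_rational {d : ℕ} {f : 𝒳 ⟶ S} (hf : IsCompactAbelianPencil f d) :
    InvariantCyclesHoldFor f d ↔ ∀ (p : ℕ) (W : complexBetti 𝒳 (2 * p)), IsRationalClass W →
      (∃ s₀ : ComplexPoints S, complexBetti.map (fiberι f s₀) (2 * p) W ∈ algebraicClasses (fiberOver f s₀) p) →
      ∀ s : ComplexPoints S, complexBetti.map (fiberι f s) (2 * p) W ∈ algebraicClasses (fiberOver f s) p := by
  refine ⟨fun h p W hW hs₀ ↦ ?_, fun h p W hW hs₀ s ↦ ?_⟩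
  · obtain ⟨s₀, h₀⟩ := hs₀
    exact h p W (fibrewiseHodge_of_isRationalClass_of_mem_algebraicClasses hf hW h₀) ⟨s₀, h₀⟩
  · obtain ⟨s₀, h₀⟩ := hs₀
    obtain ⟨W₀, hW₀, hW₀s⟩ := exists_isRationalClass_map_fiberι_eq_of_fibrewiseHodge hf W hW s₀
    rw [← hW₀s s]
    exact h p W₀ hW₀ ⟨s₀, by rw [hW₀s s₀]; exact h₀⟩ s

/-- **(2) without its Hodge binder**: `Deform.CompactAbelianPencilVHC` ⟺ on every compact pencil of abelian
varieties, a RATIONAL class of the total space algebraic on one fibre is algebraic on every fibre.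
[cite: Andre1996Motifs, §6.3 Remarque 2 (p. 33)] [cite: Abdulali1994FamiliesAV, (1.1) (p. 1122)] -/
theorem compactAbelianPencilVHC_iff_rational :
    CompactAbelianPencilVHC ↔ ∀ ⦃d : ℕ⦄ ⦃𝒳 S : SchemeOver ℂ⦄ (f : 𝒳 ⟶ S), IsCompactAbelianPencil f d →
      ∀ (p : ℕ) (W : complexBetti 𝒳 (2 * p)), IsRationalClass W →
        (∃ s₀ : ComplexPoints S, complexBetti.map (fiberι f s₀) (2 * p) W ∈ algebraicClasses (fiberOver f s₀) p) →
        ∀ s : ComplexPoints S, complexBetti.map (fiberι f s) (2 * p) W ∈ algebraicClasses (fiberOver f s) p :=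
  ⟨fun h _ _ _ f hf ↦ (invariantCyclesHoldFor_iff_rational hf).1 (h f hf),
    fun h _ _ _ f hf ↦ (invariantCyclesHoldFor_iff_rational hf).2 (h f hf)⟩

/-- **(3) without its Hodge binder**: `CMPointedPencilVHC` ⟺ the same on compact pencils with a CM fibre.
[cite: Andre1996Motifs, Lemme 6.3.1 (p. 31) and Remarque 2 (p. 33)] [cite: Abdulali1994FamiliesAV, (1.1) (p. 1122)] -/
theorem cmPointedPencilVHC_iff_rational :
    CMPointedPencilVHC ↔ ∀ ⦃d : ℕ⦄ ⦃𝒳 S : SchemeOver ℂ⦄ (f : 𝒳 ⟶ S), IsCompactAbelianPencil f d →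
      (cmLocus f d).Nonempty → ∀ (p : ℕ) (W : complexBetti 𝒳 (2 * p)), IsRationalClass W →
        (∃ s₀ : ComplexPoints S, complexBetti.map (fiberι f s₀) (2 * p) W ∈ algebraicClasses (fiberOver f s₀) p) →
        ∀ s : ComplexPoints S, complexBetti.map (fiberι f s) (2 * p) W ∈ algebraicClasses (fiberOver f s) p :=
  ⟨fun h _ _ _ f hf hne ↦ (invariantCyclesHoldFor_iff_rational hf).1 (h f hf hne),
    fun h _ _ _ f hf hne ↦ (invariantCyclesHoldFor_iff_rational hf).2 (h f hf hne)⟩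

/-- **(4) without its Hodge binder: `CMAnchoredTransport` ⟺ "on every compact pencil of abelian varieties, a
RATIONAL class of the total space which is algebraic on a CM fibre is algebraic on every fibre".**
[cite: Andre1996Motifs, §6.3 a) (p. 33)] [cite: Abdulali1994FamiliesAV, Lemma 6.2 (p. 1131)] [cite: DeligneHodgeII1971, Cor. 4.1.2] -/
theorem cmAnchoredTransport_iff_rational :
    CMAnchoredTransport ↔ ∀ ⦃d : ℕ⦄ ⦃𝒳 S : SchemeOver ℂ⦄ (f : 𝒳 ⟶ S), IsCompactAbelianPencil f d →
      ∀ (p : ℕ) (W : complexBetti 𝒳 (2 * p)), IsRationalClass W → ∀ t ∈ cmLocus f d,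
        complexBetti.map (fiberι f t) (2 * p) W ∈ algebraicClasses (fiberOver f t) p →
        ∀ s : ComplexPoints S, complexBetti.map (fiberι f s) (2 * p) W ∈ algebraicClasses (fiberOver f s) p := by
  refine ⟨fun h d 𝒳 S f hf p W hW t ht h₀ ↦ ?_, fun h d 𝒳 S f hf p W hW t ht h₀ s ↦ ?_⟩
  · exact h f hf p W (fibrewiseHodge_of_isRationalClass_of_mem_algebraicClasses hf hW h₀) t ht h₀
  · obtain ⟨W₀, hW₀, hW₀s⟩ := exists_isRationalClass_map_fiberι_eq_of_fibrewiseHodge hf W hW t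
    rw [← hW₀s s]
    exact h f hf p W₀ hW₀ t ht (by rw [hW₀s t]; exact h₀) s

/-- **(L) without its Hodge binder: `CMFibreAlgebraicLift` ⟺ "on every compact pencil of abelian varieties, a
RATIONAL class of the total space which is algebraic on a CM fibre agrees there with an ALGEBRAIC class of the
total space".** [cite: Andre1996Motifs, §5.1 (p. 25)] [cite: Milne2020HodgeClassesAV, Prop. 1, last line of the proof (p. 8)]
[cite: DeligneHodgeII1971, Cor. 4.1.2] -/
theorem cmFibreAlgebraicLift_iff_rational :
    CMFibreAlgebraicLift ↔ ∀ ⦃d : ℕ⦄ ⦃𝒳 S : SchemeOver ℂ⦄ (f : 𝒳 ⟶ S), IsCompactAbelianPencil f d →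
      ∀ (p : ℕ) (W : complexBetti 𝒳 (2 * p)), IsRationalClass W → ∀ t ∈ cmLocus f d,
        complexBetti.map (fiberι f t) (2 * p) W ∈ algebraicClasses (fiberOver f t) p →
        ∃ η ∈ algebraicClasses 𝒳 p,
          complexBetti.map (fiberι f t) (2 * p) η = complexBetti.map (fiberι f t) (2 * p) W := by
  refine ⟨fun h d 𝒳 S f hf p W hW t ht h₀ ↦ ?_, fun h d 𝒳 S f hf p W hW t ht h₀ ↦ ?_⟩
  · exact h f hf p W (fibrewiseHodge_of_isRationalClass_of_mem_algebraicClasses hf hW h₀) t ht h₀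
  · obtain ⟨W₀, hW₀, hW₀s⟩ := exists_isRationalClass_map_fiberι_eq_of_fibrewiseHodge hf W hW t
    obtain ⟨η, hη, hηt⟩ := h f hf p W₀ hW₀ t ht (by rw [hW₀s t]; exact h₀)
    exact ⟨η, hη, by rw [hηt, hW₀s t]⟩

/-- **(L∀) without its Hodge binder: `AlgebraicFixedPart` ⟺ "on every compact pencil of abelian varieties, a
RATIONAL class of the total space which is algebraic on a fibre agrees there with an ALGEBRAIC class of the total
space"** — the specialisation map `N^p(𝒳) → N^p(𝒳_{s₀}) ∩ im H²ᵖ(𝒳; ℚ)` is onto, for every fibre.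
[cite: Milne2020HodgeClassesAV, Prop. 1 (p. 7)] [cite: Andre1996Motifs, Remarque 2 (p. 33)] [cite: DeligneHodgeII1971, Cor. 4.1.2] -/
theorem algebraicFixedPart_iff_rational :
    AlgebraicFixedPart ↔ ∀ ⦃d : ℕ⦄ ⦃𝒳 S : SchemeOver ℂ⦄ (f : 𝒳 ⟶ S), IsCompactAbelianPencil f d →
      ∀ (p : ℕ) (W : complexBetti 𝒳 (2 * p)), IsRationalClass W → ∀ s₀ : ComplexPoints S,
        complexBetti.map (fiberι f s₀) (2 * p) W ∈ algebraicClasses (fiberOver f s₀) p →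
        ∃ η ∈ algebraicClasses 𝒳 p,
          complexBetti.map (fiberι f s₀) (2 * p) η = complexBetti.map (fiberι f s₀) (2 * p) W := by
  refine ⟨fun h d 𝒳 S f hf p W hW s₀ h₀ ↦ ?_, fun h d 𝒳 S f hf p W hW s₀ h₀ ↦ ?_⟩
  · exact h f hf p W (fibrewiseHodge_of_isRationalClass_of_mem_algebraicClasses hf hW h₀) s₀ h₀
  · obtain ⟨W₀, hW₀, hW₀s⟩ := exists_isRationalClass_map_fiberι_eq_of_fibrewiseHodge hf W hW s₀
    obtain ⟨η, hη, hηt⟩ := h f hf p W₀ hW₀ s₀ (by rw [hW₀s s₀]; exact h₀)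
    exact ⟨η, hη, by rw [hηt, hW₀s s₀]⟩

/-- **(4) with rationality read at the CM fibre only**: `CMAnchoredTransport` ⟺ "on every compact pencil of
abelian varieties, a class of the total space whose restriction to a CM fibre is a RATIONAL ALGEBRAIC class is
algebraic on every fibre" (§1: rationality at `t` is rationality of a global lift).
[cite: Andre1996Motifs, §6.3 a) (p. 33)] [cite: DeligneHodgeII1971, Cor. 4.1.2] -/
theorem cmAnchoredTransport_iff_rational_at :
    CMAnchoredTransport ↔ ∀ ⦃d : ℕ⦄ ⦃𝒳 S : SchemeOver ℂ⦄ (f : 𝒳 ⟶ S), IsCompactAbelianPencil f d →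
      ∀ (p : ℕ) (W : complexBetti 𝒳 (2 * p)), ∀ t ∈ cmLocus f d,
        IsRationalClass (complexBetti.map (fiberι f t) (2 * p) W) →
        complexBetti.map (fiberι f t) (2 * p) W ∈ algebraicClasses (fiberOver f t) p →
        ∀ s : ComplexPoints S, complexBetti.map (fiberι f s) (2 * p) W ∈ algebraicClasses (fiberOver f s) p := by
  rw [cmAnchoredTransport_iff_rational]
  refine ⟨fun h d 𝒳 S f hf p W t ht hrat h₀ s ↦ ?_, fun h d 𝒳 S f hf p W hW t ht h₀ ↦ ?_⟩
  · obtain ⟨W₀, hW₀, hW₀s⟩ := exists_isRationalClass_map_fiberι_eq hf W hrat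
    rw [← hW₀s s]
    exact h f hf p W₀ hW₀ t ht (by rw [hW₀s t]; exact h₀) s
  · exact h f hf p W t ht (hW.map (AlgPoints.mapContinuous (L := ℂ) (fiberι f t))) h₀

/-- **(L) with rationality read at the CM fibre only.** [cite: Andre1996Motifs, §5.1 (p. 25)] [cite: DeligneHodgeII1971, Cor. 4.1.2] -/
theorem cmFibreAlgebraicLift_iff_rational_at :
    CMFibreAlgebraicLift ↔ ∀ ⦃d : ℕ⦄ ⦃𝒳 S : SchemeOver ℂ⦄ (f : 𝒳 ⟶ S), IsCompactAbelianPencil f d →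
      ∀ (p : ℕ) (W : complexBetti 𝒳 (2 * p)), ∀ t ∈ cmLocus f d,
        IsRationalClass (complexBetti.map (fiberι f t) (2 * p) W) →
        complexBetti.map (fiberι f t) (2 * p) W ∈ algebraicClasses (fiberOver f t) p →
        ∃ η ∈ algebraicClasses 𝒳 p,
          complexBetti.map (fiberι f t) (2 * p) η = complexBetti.map (fiberι f t) (2 * p) W := by
  rw [cmFibreAlgebraicLift_iff_rational]
  refine ⟨fun h d 𝒳 S f hf p W t ht hrat h₀ ↦ ?_, fun h d 𝒳 S f hf p W hW t ht h₀ ↦ ?_⟩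
  · obtain ⟨W₀, hW₀, hW₀s⟩ := exists_isRationalClass_map_fiberι_eq hf W hrat
    obtain ⟨η, hη, hηt⟩ := h f hf p W₀ hW₀ t ht (by rw [hW₀s t]; exact h₀)
    exact ⟨η, hη, by rw [hηt, hW₀s t]⟩
  · exact h f hf p W t ht (hW.map (AlgPoints.mapContinuous (L := ℂ) (fiberι f t))) h₀

/-- The assembled row of part I with the node in its rational form: `HC_CM` ∧ "(4) for rational classes" ⟹
`HC_AV` (modulo André's Lemme 6.3.1, binder `h₂₁`, as in part I). `HC_CM` a BINDER.
[cite: Andre1996Motifs, Lemme 6.3.1 (p. 31) and §6.3 a) (p. 33)] -/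
theorem HC_AV_of_HC_CM_and_cmAnchoredTransport_rational
    (h₂₁ : Literature.AlgebraicGeometry.Andre1996.andre1996_cmAnchoredPencil)
    (hCM : Theses.RankFourFaces.CMAbelianHodge)
    (hB : ∀ ⦃d : ℕ⦄ ⦃𝒳 S : SchemeOver ℂ⦄ (f : 𝒳 ⟶ S), IsCompactAbelianPencil f d →
      ∀ (p : ℕ) (W : complexBetti 𝒳 (2 * p)), IsRationalClass W → ∀ t ∈ cmLocus f d,
        complexBetti.map (fiberι f t) (2 * p) W ∈ algebraicClasses (fiberOver f t) p →
        ∀ s : ComplexPoints S, complexBetti.map (fiberι f s) (2 * p) W ∈ algebraicClasses (fiberOver f s) p) :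
    Theses.PadicSemiregularLift.HodgeAbelianVarieties :=
  HC_AV_of_HC_CM_and_Bmin h₂₁ hCM (cmAnchoredTransport_iff_rational.2 hB)

end Summit.HodgeConjecture.HodgeConjecture.Ring2.AbelianAll

end
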